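import Literature.MathematicalPhysics.QuantumFieldTheory.WilsonFinTorusTwistedPartition
import Literature.MathematicalPhysics.QuantumFieldTheory.WilsonFinTorusPartitionSymmetry
import HarnessLib

/-!
# Axis relabelling of 't Hooft's twisted partition function: reading a temporal twist in the other direction

Companion of `WilsonFinTorusTwistedPartition.lean` (the temporally twisted Wilson partition function
`wilsonFinTorusTwistedPartition ρ β z n₀ n₁ n₂ n₃` of the anisotropic `Fin`-box, twist `z μ` on the stack
`{x₃ = 0, x_μ = 0}` of `(μ, 3)`-plaquettes, and its time slicing along the LAST axis) and of
`WilsonFinTorusPartitionSymmetry.lean` (axis relabelling of the UNTWISTED partition function).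

't Hooft's basic remark ('t Hooft 1979 §2, after (2.6); §6 (6.1)–(6.2)): the twisted functional integral
`W{n_{μν}; a_μ}` is invariant under the simultaneous permutations of the twist tensor `n_{μν}` and of the box
sides `a_μ` induced by rotations of Euclidean 4-space; in particular the twist of the `(0, 3)` plane can be read
with EITHER axis as Euclidean time («electric» reading along `3`, «magnetic»/spatial reading along `0` — the
exchange behind the duality (6.2)).  On the lattice (Greensite §4.4 (4.43)–(4.44): the twisted stack of one plane):

* `tHooftTwistCocycle z x μ ν = twist(μ,ν) · twist(ν,μ)⁻¹` — the ORIENTED form of the twist factor (equal to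
  `tHooftTwistFactor` on the ordered pairs `μ < ν`, inverse on the reversed pairs), so that the twisted plaquette
  term `n − Re tr ρ(c_{μν} U_{μν})` is symmetric under reversing the orientation (`U_{νμ} = U_{μν}⁻¹`,
  `Re tr ρ(g⁻¹) = Re tr ρ(g)`, cyclicity of the trace);
* `wilsonFinTorusTwistedPartition_relabel` — **covariant axis relabelling**: a site bijection `e` intertwining
  the shifts along an axis permutation `σ` carries `Z^{(z)}(a,b,c,d)` to `Z^{(z')}(a',b',c',d')` whenever the
  oriented cocycles correspond, `c_{z'}(e x; σμ, σν) = c_z(x; μ, ν)`;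
* `wilsonFinTorusTwistedPartition_swap03_update` — **the `(0,3)`-twist read along axis `0`**:
  `Z^{(c on (0,3))}_{ρ,β}(a, b, c', d) = Z^{(c⁻¹ on (0,3))}_{ρ,β}(d, b, c', a)` for EVERY `c : G` (no centrality
  needed: a change of variables): exchanging the axes `0 ↔ 3` maps the stack `{x₃ = 0, x₀ = 0}` of
  `(0,3)`-plaquettes to itself with reversed orientation, hence twist `c⁻¹`.  Combined with the time slicing of
  `WilsonFinTorusTwistedPartition.lean` applied to the box `(d, b, c', a)` this is the SECOND transfer-matrix
  reading of the same twisted integral: slices `Fin d × Fin b × Fin c'` (the old axes `3, 1, 2`), period `a`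
  (the old axis `0`), and the slice twist `finSliceTwist (update 1 0 c⁻¹)` multiplying the links of the OLD TIME
  DIRECTION `3` crossing the sheet `{x₃ = 0}` — the centre transformation that flips the Polyakov-loop sector
  (Borgs–Seiler's setting), i.e. `Tr(Ĉ₃ 𝕋₃^{d}) = Tr(Ĉ₀ 𝕋₀^{a})` in transfer-matrix notation;
* likewise `…_swap13_update`, `…_swap23_update` for the planes `(1,3)`, `(2,3)`.
* `wilsonFinTorusTwistedPartition_swap01`, `…_swap02`, `…_swap12` — **permutations of the SPATIAL axes**:
  `Z^{(z)}(a,b,c,d) = Z^{(z ∘ (0 1))}(b,a,c,d)` etc. for EVERY temporal twist family `z : Fin 4 → G` (the twist of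
  direction `i` becomes the twist of direction `σ i`; orientations of the temporal stacks are kept since `σ 3 = 3`;
  `tHooftTwistFactor_spatialPerm`, `tHooftTwistCocycle_spatialPerm` for a general `σ` fixing the time axis).
* `sum_twistedPlaquetteTerm_relabel`, `integral_mul_twistedWeight_relabel`, `integral_mul_twistedWeight_swap03_update` —
  the same relabellings for the twisted EXPONENT pointwise and for twisted integrals WITH AN OBSERVABLE INSERTED
  (`∫ Φ(U) w_z(U) dU = ∫ Φ(U' ∘ (e × σ)) w_{z'}(U') dU'`), so that Polyakov lines along the old time axis become slice
  observables (lines along the first slice axis) of the second transfer-matrix reading.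

Everything is PROVED (bookkeeping identities: change of variables in the product Haar integral); no estimate.
HONEST FRAMING: nothing here bears on electric-flux free energies, confinement, a lattice gap or the Yang–Mills
mass gap.

References: G. 't Hooft, Nucl. Phys. B 153 (1979) 141, §2 (2.6), §6 (6.1)–(6.2); J. Greensite, *An Introduction to
the Confinement Problem*, LNP 821 (2011) §4.4 (4.43)–(4.44); C. Borgs, E. Seiler, Commun. Math. Phys. 91 (1983) 329
(Polyakov loops and the centre); I. Montvay, G. Münster, *Quantum Fields on a Lattice* (1994) §3.2.6 (3.145).
-/

noncomputable section

open scoped BigOperators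
open MeasureTheory Finset
open Literature.RepresentationTheory.CompactGroups

namespace Literature.MathematicalPhysics.QuantumFieldTheory

variable {G : Type*} [Group G] {n : ℕ}

/-! ### The oriented twist cocycle (pure algebra) -/

section Algebra

/-- **The oriented twist cocycle** of the twist family `z`: `c_z(x; μ, ν) = twist(x; μ, ν) · twist(x; ν, μ)⁻¹` —
`tHooftTwistFactor z x μ ν` on the ordered pairs `μ < ν` (the orientations summed in the Wilson action), its inverse
on the reversed pairs, `1` on the diagonal ('t Hooft's antisymmetric twist tensor `n_{νμ} = −n_{μν}`, §2 (2.5)).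
[cite: tHooft1979Flux, §2 (2.3)–(2.6)] -/
def tHooftTwistCocycle (z : Fin 4 → G) {n₀ n₁ n₂ n₃ : ℕ} (x : FinTorusSite n₀ n₁ n₂ n₃) (μ ν : Fin 4) : G :=
  tHooftTwistFactor z x μ ν * (tHooftTwistFactor z x ν μ)⁻¹

/-- The twist factor vanishes (is `1`) when the second direction is not the time axis `3`. [folklore] -/
private theorem tHooftTwistFactor_of_ne_three (z : Fin 4 → G) {n₀ n₁ n₂ n₃ : ℕ} (x : FinTorusSite n₀ n₁ n₂ n₃)
    (μ : Fin 4) {ν : Fin 4} (hν : ν ≠ 3) : tHooftTwistFactor z x μ ν = 1 := by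
  simp [tHooftTwistFactor, hν]

/-- **On the ordered pairs the cocycle is the twist factor**: for `μ < ν`, `c_z(x; μ, ν) = tHooftTwistFactor z x μ ν`
(the reversed factor has second slot `μ ≤ 2`, hence is `1`). [cite: tHooft1979Flux, §2 (2.5)–(2.6)] -/
theorem tHooftTwistCocycle_of_lt (z : Fin 4 → G) {n₀ n₁ n₂ n₃ : ℕ} (x : FinTorusSite n₀ n₁ n₂ n₃) {μ ν : Fin 4}
    (h : μ < ν) : tHooftTwistCocycle z x μ ν = tHooftTwistFactor z x μ ν := by
  have hμ : μ ≠ 3 := by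
    intro h3
    rw [h3] at h
    exact absurd (Fin.le_last ν) (not_le.2 h)
  rw [tHooftTwistCocycle, tHooftTwistFactor_of_ne_three z x ν hμ, inv_one, mul_one]

/-- **The cocycle is antisymmetric**: `c_z(x; ν, μ) = c_z(x; μ, ν)⁻¹` ('t Hooft's `n_{νμ} = −n_{μν}`).
[cite: tHooft1979Flux, §2 (2.5)] -/
theorem tHooftTwistCocycle_symm (z : Fin 4 → G) {n₀ n₁ n₂ n₃ : ℕ} (x : FinTorusSite n₀ n₁ n₂ n₃) (μ ν : Fin 4) :
    tHooftTwistCocycle z x ν μ = (tHooftTwistCocycle z x μ ν)⁻¹ := by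
  unfold tHooftTwistCocycle
  group

/-- The plaquette traversed in the opposite orientation has the inverse holonomy. [folklore] -/
private theorem finTorusPlaquette_symm' {n₀ n₁ n₂ n₃ : ℕ} (U : FinTorusSite n₀ n₁ n₂ n₃ × Fin 4 → G)
    (x : FinTorusSite n₀ n₁ n₂ n₃) (μ ν : Fin 4) :
    finTorusPlaquette U x ν μ = (finTorusPlaquette U x μ ν)⁻¹ := by
  unfold finTorusPlaquette
  group

/-- Plaquettes of a relabelled configuration (as in `WilsonFinTorusPartitionSymmetry`). [folklore] -/
private theorem finTorusPlaquette_relabel' {a b c d a' b' c' d' : ℕ}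
    (e : FinTorusSite a b c d ≃ FinTorusSite a' b' c' d') (σ : Equiv.Perm (Fin 4))
    (he : ∀ x μ, e (x.shift μ) = (e x).shift (σ μ)) (U' : FinTorusSite a' b' c' d' × Fin 4 → G)
    (x : FinTorusSite a b c d) (μ ν : Fin 4) :
    finTorusPlaquette (fun l : FinTorusSite a b c d × Fin 4 => U' (e l.1, σ l.2)) x μ ν =
      finTorusPlaquette U' (e x) (σ μ) (σ ν) := by
  simp only [finTorusPlaquette, he]

/-- The sum over the ordered pairs `μ < ν` of `Fin 4`, written out. [folklore] -/
private theorem sum_pairs_eq_six' (g : Fin 4 → Fin 4 → ℝ) :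
    ∑ q : {q : Fin 4 × Fin 4 // q.1 < q.2}, g q.1.1 q.1.2 =
      g 0 1 + g 0 2 + g 0 3 + g 1 2 + g 1 3 + g 2 3 := by
  have h := Finset.sum_subtype (p := fun q : Fin 4 × Fin 4 => q.1 < q.2) (F := inferInstance)
    (Finset.univ.filter fun q : Fin 4 × Fin 4 => q.1 < q.2) (fun x => by simp)
    (fun q : Fin 4 × Fin 4 => g q.1 q.2)
  rw [← h, Finset.sum_filter, Fintype.sum_prod_type]
  simp (config := { decide := true }) only [Fin.sum_univ_four, Fin.isValue, ite_true, ite_false, add_zero,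
    zero_add, add_assoc]

/-- Twice the sum over pairs of a symmetric function is the off-diagonal sum. [folklore] -/
private theorem two_mul_sum_pairs' (g : Fin 4 → Fin 4 → ℝ) (hg : ∀ μ ν, g ν μ = g μ ν) :
    2 * ∑ q : {q : Fin 4 × Fin 4 // q.1 < q.2}, g q.1.1 q.1.2 = (∑ μ, ∑ ν, g μ ν) - ∑ μ, g μ μ := by
  rw [sum_pairs_eq_six' g]
  simp only [Fin.sum_univ_four]
  rw [hg 0 1, hg 0 2, hg 0 3, hg 1 2, hg 1 3, hg 2 3]
  ring

/-- The sum over plaquette orientations of a symmetric function is invariant under a permutation of the axes.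
[folklore] -/
private theorem sum_pairs_perm' (f : Fin 4 → Fin 4 → ℝ) (hf : ∀ μ ν, f ν μ = f μ ν) (σ : Equiv.Perm (Fin 4)) :
    ∑ q : {q : Fin 4 × Fin 4 // q.1 < q.2}, f (σ q.1.1) (σ q.1.2) =
      ∑ q : {q : Fin 4 × Fin 4 // q.1 < q.2}, f q.1.1 q.1.2 := by
  have h1 : 2 * ∑ q : {q : Fin 4 × Fin 4 // q.1 < q.2}, f (σ q.1.1) (σ q.1.2) =
      (∑ μ, ∑ ν, f (σ μ) (σ ν)) - ∑ μ, f (σ μ) (σ μ) :=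
    two_mul_sum_pairs' (fun μ ν => f (σ μ) (σ ν)) (fun μ ν => hf (σ μ) (σ ν))
  have h2 := two_mul_sum_pairs' f hf
  have h3 : (∑ μ, ∑ ν, f (σ μ) (σ ν)) = ∑ μ, ∑ ν, f μ ν :=
    calc (∑ μ, ∑ ν, f (σ μ) (σ ν)) = ∑ μ, ∑ ν, f μ (σ ν) :=
          Equiv.sum_comp σ (fun μ => ∑ ν, f μ (σ ν))
      _ = ∑ μ, ∑ ν, f μ ν := Finset.sum_congr rfl fun μ _ => Equiv.sum_comp σ (f μ)
  have h4 : (∑ μ, f (σ μ) (σ μ)) = ∑ μ, f μ μ := Equiv.sum_comp σ (fun μ => f μ μ)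
  linarith

end Algebra

/-! ### Covariant axis relabelling of the twisted partition function -/

section Relabel

variable (ρ : G →* Matrix (Fin n) (Fin n) ℂ) [TopologicalSpace G] [IsTopologicalGroup G] [CompactSpace G]
  [MeasurableSpace G] [BorelSpace G]

omit [MeasurableSpace G] [BorelSpace G] in
/-- **The twisted plaquette term, oriented form, is symmetric under orientation reversal**:
`n − Re tr ρ(c(ν,μ) U_{νμ}) = n − Re tr ρ(c(μ,ν) U_{μν})` (`U_{νμ} = U_{μν}⁻¹`, `c(ν,μ) = c(μ,ν)⁻¹`,
`Re tr ρ(g⁻¹) = Re tr ρ(g)` for compact `G`, cyclicity of the trace). [cite: tHooft1979Flux, §2 (2.5)–(2.6)] -/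
theorem re_trace_tHooftTwistCocycle_mul_symm (hρ : Continuous ρ) (z : Fin 4 → G) {n₀ n₁ n₂ n₃ : ℕ}
    (U : FinTorusSite n₀ n₁ n₂ n₃ × Fin 4 → G) (x : FinTorusSite n₀ n₁ n₂ n₃) (μ ν : Fin 4) :
    (ρ (tHooftTwistCocycle z x ν μ * finTorusPlaquette U x ν μ)).trace.re =
      (ρ (tHooftTwistCocycle z x μ ν * finTorusPlaquette U x μ ν)).trace.re := by
  rw [tHooftTwistCocycle_symm z x μ ν, finTorusPlaquette_symm' U x μ ν, ← mul_inv_rev,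
    CompactGroup.re_trace_map_inv ρ hρ, map_mul, map_mul, Matrix.trace_mul_comm]

omit [MeasurableSpace G] [BorelSpace G] in
/-- **The twisted Wilson exponent is covariant under axis relabelling**: if a site bijection
`e : FinTorusSite a b c d ≃ FinTorusSite a' b' c' d'` intertwines the shifts along a permutation `σ` of the axes and
the oriented cocycles correspond, then for every configuration `U'` of the target box the twisted action of the
pulled-back configuration `U = U' ∘ (e × σ)` with twist `z` equals the twisted action of `U'` with twist `z'`
(plaquettes go to plaquettes up to orientation; 't Hooft: `W{n_{μν}; a_μ}` is invariant under joint rotations of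
`n_{μν}` and `a_μ`). [cite: tHooft1979Flux, §2 (2.6) and §6 (6.1)–(6.2)] -/
theorem sum_twistedPlaquetteTerm_relabel (hρ : Continuous ρ) {a b c d a' b' c' d' : ℕ}
    (e : FinTorusSite a b c d ≃ FinTorusSite a' b' c' d') (σ : Equiv.Perm (Fin 4))
    (he : ∀ x μ, e (x.shift μ) = (e x).shift (σ μ)) {z z' : Fin 4 → G}
    (hcov : ∀ x μ ν, tHooftTwistCocycle z' (e x) (σ μ) (σ ν) = tHooftTwistCocycle z x μ ν)
    (U' : FinTorusSite a' b' c' d' × Fin 4 → G) :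
    (∑ x : FinTorusSite a b c d, ∑ q : {q : Fin 4 × Fin 4 // q.1 < q.2},
        ((n : ℝ) - (ρ (tHooftTwistFactor z x q.1.1 q.1.2 *
          finTorusPlaquette (fun l : FinTorusSite a b c d × Fin 4 => U' (e l.1, σ l.2)) x q.1.1 q.1.2)).trace.re)) =
      ∑ x' : FinTorusSite a' b' c' d', ∑ q : {q : Fin 4 × Fin 4 // q.1 < q.2},
        ((n : ℝ) - (ρ (tHooftTwistFactor z' x' q.1.1 q.1.2 * finTorusPlaquette U' x' q.1.1 q.1.2)).trace.re) := by
  -- on ordered pairs the twist factor is the oriented cocycle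
  have hlt : ∀ (w : Fin 4 → G) {m₀ m₁ m₂ m₃ : ℕ} (y : FinTorusSite m₀ m₁ m₂ m₃)
      (V : FinTorusSite m₀ m₁ m₂ m₃ × Fin 4 → G),
      (∑ q : {q : Fin 4 × Fin 4 // q.1 < q.2},
          ((n : ℝ) - (ρ (tHooftTwistFactor w y q.1.1 q.1.2 * finTorusPlaquette V y q.1.1 q.1.2)).trace.re)) =
        ∑ q : {q : Fin 4 × Fin 4 // q.1 < q.2},
          ((n : ℝ) - (ρ (tHooftTwistCocycle w y q.1.1 q.1.2 * finTorusPlaquette V y q.1.1 q.1.2)).trace.re) :=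
    fun w _ _ _ _ y V => Finset.sum_congr rfl fun q _ => by rw [tHooftTwistCocycle_of_lt w y q.2]
  simp_rw [hlt, finTorusPlaquette_relabel' e σ he U']
  calc (∑ x : FinTorusSite a b c d, ∑ q : {q : Fin 4 × Fin 4 // q.1 < q.2},
        ((n : ℝ) - (ρ (tHooftTwistCocycle z x q.1.1 q.1.2 *
          finTorusPlaquette U' (e x) (σ q.1.1) (σ q.1.2))).trace.re))
      = ∑ x : FinTorusSite a b c d, ∑ q : {q : Fin 4 × Fin 4 // q.1 < q.2},
          ((n : ℝ) - (ρ (tHooftTwistCocycle z' (e x) (σ q.1.1) (σ q.1.2) *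
            finTorusPlaquette U' (e x) (σ q.1.1) (σ q.1.2))).trace.re) := by
        simp_rw [hcov]
    _ = ∑ x' : FinTorusSite a' b' c' d', ∑ q : {q : Fin 4 × Fin 4 // q.1 < q.2},
          ((n : ℝ) - (ρ (tHooftTwistCocycle z' x' (σ q.1.1) (σ q.1.2) *
            finTorusPlaquette U' x' (σ q.1.1) (σ q.1.2))).trace.re) :=
        Equiv.sum_comp e (fun x' => ∑ q : {q : Fin 4 × Fin 4 // q.1 < q.2},
          ((n : ℝ) - (ρ (tHooftTwistCocycle z' x' (σ q.1.1) (σ q.1.2) *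
            finTorusPlaquette U' x' (σ q.1.1) (σ q.1.2))).trace.re))
    _ = ∑ x' : FinTorusSite a' b' c' d', ∑ q : {q : Fin 4 × Fin 4 // q.1 < q.2},
          ((n : ℝ) - (ρ (tHooftTwistCocycle z' x' q.1.1 q.1.2 * finTorusPlaquette U' x' q.1.1 q.1.2)).trace.re) :=
        Finset.sum_congr rfl fun x' _ =>
          sum_pairs_perm' (fun μ ν => (n : ℝ) - (ρ (tHooftTwistCocycle z' x' μ ν *
            finTorusPlaquette U' x' μ ν)).trace.re)
            (fun μ ν => by
              show ((n : ℝ) - (ρ (tHooftTwistCocycle z' x' ν μ * finTorusPlaquette U' x' ν μ)).trace.re) =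
                (n : ℝ) - (ρ (tHooftTwistCocycle z' x' μ ν * finTorusPlaquette U' x' μ ν)).trace.re
              rw [re_trace_tHooftTwistCocycle_mul_symm ρ hρ z' U' x' μ ν]) σ

/-- **Covariant axis relabelling of twisted integrals with an observable inserted.**  Under the hypotheses of
`sum_twistedPlaquetteTerm_relabel`, for EVERY functional `Φ` of the link configuration of the source box,
`∫ Φ(U) w_z(U) ∏ dU = ∫ Φ(U' ∘ (e × σ)) w_{z'}(U') ∏ dU'` (`w_z(U) = exp(−β Σ_x Σ_{μ<ν} (n − Re tr ρ(z_{x,μν} U_{x,μν})))`):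
the link relabelling `(x, μ) ↦ (e x, σ μ)` preserves the product Haar measure.  No measurability of `Φ` is needed
(change of variables along a measurable equivalence). [cite: tHooft1979Flux, §2 (2.6) and §6 (6.1)–(6.2)] [cite: MontvayMunster1994, §3.2.6 (3.145)] -/
theorem integral_mul_twistedWeight_relabel (hρ : Continuous ρ) (β : ℝ) {a b c d a' b' c' d' : ℕ}
    (e : FinTorusSite a b c d ≃ FinTorusSite a' b' c' d') (σ : Equiv.Perm (Fin 4))
    (he : ∀ x μ, e (x.shift μ) = (e x).shift (σ μ)) {z z' : Fin 4 → G}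
    (hcov : ∀ x μ ν, tHooftTwistCocycle z' (e x) (σ μ) (σ ν) = tHooftTwistCocycle z x μ ν)
    (Φ : (FinTorusSite a b c d × Fin 4 → G) → ℝ) :
    ∫ U, Φ U * Real.exp (-β * ∑ x : FinTorusSite a b c d, ∑ q : {q : Fin 4 × Fin 4 // q.1 < q.2},
        ((n : ℝ) - (ρ (tHooftTwistFactor z x q.1.1 q.1.2 * finTorusPlaquette U x q.1.1 q.1.2)).trace.re))
        ∂(Measure.pi fun _ : FinTorusSite a b c d × Fin 4 => haarProbability G) =
      ∫ U', Φ (fun l : FinTorusSite a b c d × Fin 4 => U' (e l.1, σ l.2)) *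
        Real.exp (-β * ∑ x' : FinTorusSite a' b' c' d', ∑ q : {q : Fin 4 × Fin 4 // q.1 < q.2},
          ((n : ℝ) - (ρ (tHooftTwistFactor z' x' q.1.1 q.1.2 * finTorusPlaquette U' x' q.1.1 q.1.2)).trace.re))
        ∂(Measure.pi fun _ : FinTorusSite a' b' c' d' × Fin 4 => haarProbability G) := by
  -- the relabelling of the links and the induced pull-back of configurations
  have hΨ : MeasurePreserving
      (MeasurableEquiv.arrowCongr' (e.prodCongr σ).symm (MeasurableEquiv.refl G) :
        (FinTorusSite a' b' c' d' × Fin 4 → G) → (FinTorusSite a b c d × Fin 4 → G))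
      (Measure.pi fun _ : FinTorusSite a' b' c' d' × Fin 4 => haarProbability G)
      (Measure.pi fun _ : FinTorusSite a b c d × Fin 4 => haarProbability G) :=
    measurePreserving_arrowCongr' (fun _ => haarProbability G) (fun _ => haarProbability G)
      (e.prodCongr σ).symm (MeasurableEquiv.refl G) fun _ => MeasurePreserving.id _
  have hΨU : ∀ U' : FinTorusSite a' b' c' d' × Fin 4 → G,
      (MeasurableEquiv.arrowCongr' (e.prodCongr σ).symm (MeasurableEquiv.refl G) U' :
        FinTorusSite a b c d × Fin 4 → G) = fun l => U' (e l.1, σ l.2) := fun U' => by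
    funext l
    rfl
  refine (Eq.trans (integral_congr_ae (ae_of_all _ fun U' => ?_)) (hΨ.integral_comp'
    (fun U : FinTorusSite a b c d × Fin 4 → G => Φ U * Real.exp (-β * ∑ x : FinTorusSite a b c d,
      ∑ q : {q : Fin 4 × Fin 4 // q.1 < q.2},
        ((n : ℝ) - (ρ (tHooftTwistFactor z x q.1.1 q.1.2 * finTorusPlaquette U x q.1.1 q.1.2)).trace.re))))).symm
  rw [hΨU U', sum_twistedPlaquetteTerm_relabel ρ hρ e σ he hcov U']

/-- **Covariant axis relabelling of the twisted Wilson partition function.**  If a site bijection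
`e : FinTorusSite a b c d ≃ FinTorusSite a' b' c' d'` intertwines the shifts along a permutation `σ` of the axes,
`e (x + e_μ) = e x + e_{σ μ}`, and the oriented twist cocycles correspond, `c_{z'}(e x; σμ, σν) = c_z(x; μ, ν)`,
then `Z^{(z)}_{ρ,β}(a,b,c,d) = Z^{(z')}_{ρ,β}(a',b',c',d')` (continuous `ρ`, compact `G`, any real `β`, ANY `z, z'`):
the link relabelling `(x, μ) ↦ (e x, σ μ)` preserves the product Haar measure and carries twisted plaquette terms
to twisted plaquette terms up to orientation ('t Hooft: `W{n_{μν}; a_μ}` is invariant under joint rotations of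
`n_{μν}` and `a_μ`). [cite: tHooft1979Flux, §2 (2.6) and §6 (6.1)–(6.2)] [cite: MontvayMunster1994, §3.2.6 (3.145)] -/
theorem wilsonFinTorusTwistedPartition_relabel (hρ : Continuous ρ) (β : ℝ) {a b c d a' b' c' d' : ℕ}
    (e : FinTorusSite a b c d ≃ FinTorusSite a' b' c' d') (σ : Equiv.Perm (Fin 4))
    (he : ∀ x μ, e (x.shift μ) = (e x).shift (σ μ)) {z z' : Fin 4 → G}
    (hcov : ∀ x μ ν, tHooftTwistCocycle z' (e x) (σ μ) (σ ν) = tHooftTwistCocycle z x μ ν) :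
    wilsonFinTorusTwistedPartition ρ β z a b c d = wilsonFinTorusTwistedPartition ρ β z' a' b' c' d' := by
  have h := integral_mul_twistedWeight_relabel ρ hρ β e σ he hcov fun _ => (1 : ℝ)
  simp only [one_mul] at h
  exact h

/-! ### The three temporal planes read along their spatial axis -/

/-- Coordinates of the `0 ↔ 3` swapped site. [folklore] -/
private theorem coord_swap03 {a b c d : ℕ} (x : FinTorusSite a b c d) (μ : Fin 4) :
    finTorusSiteCoord ((x.2.2.2, x.2.1, x.2.2.1, x.1) : FinTorusSite d b c a) μ =
      finTorusSiteCoord x (Equiv.swap (0 : Fin 4) 3 μ) := by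
  fin_cases μ <;> rfl

/-- Coordinates of the `1 ↔ 3` swapped site. [folklore] -/
private theorem coord_swap13 {a b c d : ℕ} (x : FinTorusSite a b c d) (μ : Fin 4) :
    finTorusSiteCoord ((x.1, x.2.2.2, x.2.2.1, x.2.1) : FinTorusSite a d c b) μ =
      finTorusSiteCoord x (Equiv.swap (1 : Fin 4) 3 μ) := by
  fin_cases μ <;> rfl

/-- Coordinates of the `2 ↔ 3` swapped site. [folklore] -/
private theorem coord_swap23 {a b c d : ℕ} (x : FinTorusSite a b c d) (μ : Fin 4) :
    finTorusSiteCoord ((x.1, x.2.1, x.2.2.2, x.2.2.1) : FinTorusSite a b d c) μ =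
      finTorusSiteCoord x (Equiv.swap (2 : Fin 4) 3 μ) := by
  fin_cases μ <;> rfl

omit [TopologicalSpace G] [IsTopologicalGroup G] [CompactSpace G] [MeasurableSpace G] [BorelSpace G] in
/-- **The single-plane cocycle under the exchange of its two axes**: swapping the axes `i` and `3` in the site
(`y` with `coord y = coord x ∘ swap i 3`) turns the cocycle of the twist `c` on the plane `(i, 3)`, read on the
swapped directions, into the cocycle of the twist `c⁻¹` on the same plane — the stack `{x₃ = 0, x_i = 0}` is
mapped to itself with its plaquettes traversed backwards. [cite: tHooft1979Flux, §6 (6.1)–(6.2)] -/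
theorem tHooftTwistCocycle_update_swap {a b c d a' b' c' d' : ℕ} (i : Fin 4) (hi : i ≠ 3) (g : G)
    (x : FinTorusSite a b c d) (y : FinTorusSite a' b' c' d')
    (hy : ∀ μ, finTorusSiteCoord y μ = finTorusSiteCoord x (Equiv.swap i 3 μ)) (μ ν : Fin 4) :
    tHooftTwistCocycle (Function.update (1 : Fin 4 → G) i g⁻¹) y (Equiv.swap i 3 μ) (Equiv.swap i 3 ν) =
      tHooftTwistCocycle (Function.update (1 : Fin 4 → G) i g) x μ ν := by
  revert hy hi
  fin_cases i <;> intro hi hy <;> fin_cases μ <;> fin_cases ν <;>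
    simp (config := { decide := true }) [tHooftTwistCocycle, tHooftTwistFactor,
      Equiv.swap_apply_def, hy, and_comm] at hi ⊢ <;> split <;> simp

/-- **The `(0,3)`-twist read along axis `0`**: `Z^{(c on (0,3))}_{ρ,β}(a,b,c',d) = Z^{(c⁻¹ on (0,3))}_{ρ,β}(d,b,c',a)` —
exchange of the axes `0 ↔ 3` (site bijection `(x₀,x₁,x₂,x₃) ↦ (x₃,x₁,x₂,x₀)`), for EVERY `c : G` and real `β`.
With `wilsonFinTorusTwistedPartition_eq_integral_prod_finTorusSliceKernel` applied to the right-hand side (box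
`(d, b, c', a)`: period `a` = the old axis `0`, slices `Fin d × Fin b × Fin c'`, slice twist on the links of the old
time direction crossing `{x₃ = 0}` — the centre transformation of the Polyakov loops) this is the second
transfer-matrix reading `Tr(Ĉ₃ 𝕋₃^{d}) = Tr(Ĉ₀ 𝕋₀^{a})` of the same twisted integral.
[cite: tHooft1979Flux, §6 (6.1)–(6.2)] [cite: Greensite2011, §4.4 (4.43)–(4.44)] -/
theorem wilsonFinTorusTwistedPartition_swap03_update (hρ : Continuous ρ) (β : ℝ) (g : G) (a b c d : ℕ) :
    wilsonFinTorusTwistedPartition ρ β (Function.update (1 : Fin 4 → G) 0 g) a b c d =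
      wilsonFinTorusTwistedPartition ρ β (Function.update (1 : Fin 4 → G) 0 g⁻¹) d b c a :=
  wilsonFinTorusTwistedPartition_relabel ρ hρ β
    (⟨fun x => (x.2.2.2, x.2.1, x.2.2.1, x.1), fun y => (y.2.2.2, y.2.1, y.2.2.1, y.1), fun _ => rfl, fun _ => rfl⟩ :
      FinTorusSite a b c d ≃ FinTorusSite d b c a)
    (Equiv.swap 0 3) (fun x μ => by fin_cases μ <;> rfl)
    (fun x μ ν => tHooftTwistCocycle_update_swap 0 (by decide) g x _ (coord_swap03 x) μ ν)

/-- **The `(1,3)`-twist read along axis `1`**: `Z^{(c on (1,3))}(a,b,c',d) = Z^{(c⁻¹ on (1,3))}(a,d,c',b)` (exchange of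
the axes `1 ↔ 3`). [cite: tHooft1979Flux, §6 (6.1)–(6.2)] -/
theorem wilsonFinTorusTwistedPartition_swap13_update (hρ : Continuous ρ) (β : ℝ) (g : G) (a b c d : ℕ) :
    wilsonFinTorusTwistedPartition ρ β (Function.update (1 : Fin 4 → G) 1 g) a b c d =
      wilsonFinTorusTwistedPartition ρ β (Function.update (1 : Fin 4 → G) 1 g⁻¹) a d c b :=
  wilsonFinTorusTwistedPartition_relabel ρ hρ β
    (⟨fun x => (x.1, x.2.2.2, x.2.2.1, x.2.1), fun y => (y.1, y.2.2.2, y.2.2.1, y.2.1), fun _ => rfl, fun _ => rfl⟩ :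
      FinTorusSite a b c d ≃ FinTorusSite a d c b)
    (Equiv.swap 1 3) (fun x μ => by fin_cases μ <;> rfl)
    (fun x μ ν => tHooftTwistCocycle_update_swap 1 (by decide) g x _ (coord_swap13 x) μ ν)

/-- **The `(2,3)`-twist read along axis `2`**: `Z^{(c on (2,3))}(a,b,c',d) = Z^{(c⁻¹ on (2,3))}(a,b,d,c')` (exchange of
the axes `2 ↔ 3`). [cite: tHooft1979Flux, §6 (6.1)–(6.2)] -/
theorem wilsonFinTorusTwistedPartition_swap23_update (hρ : Continuous ρ) (β : ℝ) (g : G) (a b c d : ℕ) :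
    wilsonFinTorusTwistedPartition ρ β (Function.update (1 : Fin 4 → G) 2 g) a b c d =
      wilsonFinTorusTwistedPartition ρ β (Function.update (1 : Fin 4 → G) 2 g⁻¹) a b d c :=
  wilsonFinTorusTwistedPartition_relabel ρ hρ β
    (⟨fun x => (x.1, x.2.1, x.2.2.2, x.2.2.1), fun y => (y.1, y.2.1, y.2.2.2, y.2.2.1), fun _ => rfl, fun _ => rfl⟩ :
      FinTorusSite a b c d ≃ FinTorusSite a b d c)
    (Equiv.swap 2 3) (fun x μ => by fin_cases μ <;> rfl)
    (fun x μ ν => tHooftTwistCocycle_update_swap 2 (by decide) g x _ (coord_swap23 x) μ ν)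

/-- **The `(0,3)`-twist read along axis `0`, with an observable inserted**: for every functional `Φ` of the link
configuration of the box `(a, b, c', d)` and every `c : G`,
`∫ Φ(U) w_{c on (0,3)}(U) ∏ dU = ∫ Φ(U' ∘ swap₀₃) w_{c⁻¹ on (0,3)}(U') ∏ dU'` over the box `(d, b, c', a)`, where
`(U' ∘ swap₀₃)((x₀,x₁,x₂,x₃), μ) = U'((x₃,x₁,x₂,x₀), (0 3)·μ)` — so a Wilson line of `U` along the old time axis `3` at
spatial position `(x₀, x₁, x₂)` is the line of `U'` along the NEW FIRST axis inside the slice `x₀` of the new time axis,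
i.e. a slice observable of the second transfer-matrix reading (Polyakov loops as multiplication operators, Borgs–Seiler's
setting). [cite: tHooft1979Flux, §6 (6.1)–(6.2)] [cite: BorgsSeiler1983, §II.3 Lemma II.4 (p. 336)] -/
theorem integral_mul_twistedWeight_swap03_update (hρ : Continuous ρ) (β : ℝ) (g : G) (a b c d : ℕ)
    (Φ : (FinTorusSite a b c d × Fin 4 → G) → ℝ) :
    ∫ U, Φ U * Real.exp (-β * ∑ x : FinTorusSite a b c d, ∑ q : {q : Fin 4 × Fin 4 // q.1 < q.2},
        ((n : ℝ) - (ρ (tHooftTwistFactor (Function.update (1 : Fin 4 → G) 0 g) x q.1.1 q.1.2 *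
          finTorusPlaquette U x q.1.1 q.1.2)).trace.re))
        ∂(Measure.pi fun _ : FinTorusSite a b c d × Fin 4 => haarProbability G) =
      ∫ U', Φ (fun l : FinTorusSite a b c d × Fin 4 =>
          U' ((l.1.2.2.2, l.1.2.1, l.1.2.2.1, l.1.1), Equiv.swap (0 : Fin 4) 3 l.2)) *
        Real.exp (-β * ∑ x' : FinTorusSite d b c a, ∑ q : {q : Fin 4 × Fin 4 // q.1 < q.2},
          ((n : ℝ) - (ρ (tHooftTwistFactor (Function.update (1 : Fin 4 → G) 0 g⁻¹) x' q.1.1 q.1.2 *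
            finTorusPlaquette U' x' q.1.1 q.1.2)).trace.re))
        ∂(Measure.pi fun _ : FinTorusSite d b c a × Fin 4 => haarProbability G) :=
  integral_mul_twistedWeight_relabel ρ hρ β
    (⟨fun x => (x.2.2.2, x.2.1, x.2.2.1, x.1), fun y => (y.2.2.2, y.2.1, y.2.2.1, y.1), fun _ => rfl, fun _ => rfl⟩ :
      FinTorusSite a b c d ≃ FinTorusSite d b c a)
    (Equiv.swap 0 3) (fun x μ => by fin_cases μ <;> rfl)
    (fun x μ ν => tHooftTwistCocycle_update_swap 0 (by decide) g x _ (coord_swap03 x) μ ν) Φ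

/-! ### Permutations of the SPATIAL axes: the twist family is relabelled, the box sides are permuted -/

/-- Coordinates of the `0 ↔ 1` swapped site. [folklore] -/
private theorem coord_swap01 {a b c d : ℕ} (x : FinTorusSite a b c d) (μ : Fin 4) :
    finTorusSiteCoord ((x.2.1, x.1, x.2.2.1, x.2.2.2) : FinTorusSite b a c d) μ =
      finTorusSiteCoord x (Equiv.swap (0 : Fin 4) 1 μ) := by
  fin_cases μ <;> rfl

/-- Coordinates of the `0 ↔ 2` swapped site. [folklore] -/
private theorem coord_swap02 {a b c d : ℕ} (x : FinTorusSite a b c d) (μ : Fin 4) :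
    finTorusSiteCoord ((x.2.2.1, x.2.1, x.1, x.2.2.2) : FinTorusSite c b a d) μ =
      finTorusSiteCoord x (Equiv.swap (0 : Fin 4) 2 μ) := by
  fin_cases μ <;> rfl

/-- Coordinates of the `1 ↔ 2` swapped site. [folklore] -/
private theorem coord_swap12 {a b c d : ℕ} (x : FinTorusSite a b c d) (μ : Fin 4) :
    finTorusSiteCoord ((x.1, x.2.2.1, x.2.1, x.2.2.2) : FinTorusSite a c b d) μ =
      finTorusSiteCoord x (Equiv.swap (1 : Fin 4) 2 μ) := by
  fin_cases μ <;> rfl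

omit [TopologicalSpace G] [IsTopologicalGroup G] [CompactSpace G] [MeasurableSpace G] [BorelSpace G] in
/-- **The temporal twist factor under a permutation of the spatial axes**: if `σ` fixes the time axis `3` and the
site `y` has coordinates `coord y (σ μ) = coord x μ`, then the twist family `z ∘ σ⁻¹` read at `y` on the permuted
directions is the twist family `z` read at `x` — the stack `{x₃ = 0, x_μ = 0}` of `(μ,3)`-plaquettes goes to the stack
`{y₃ = 0, y_{σμ} = 0}` of `(σμ, 3)`-plaquettes with its orientation KEPT (`σμ < 3`). [cite: tHooft1979Flux, §2 after (2.6)] -/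
theorem tHooftTwistFactor_spatialPerm {a b c d a' b' c' d' : ℕ} (σ : Equiv.Perm (Fin 4)) (hσ : σ 3 = 3)
    (z : Fin 4 → G) (x : FinTorusSite a b c d) (y : FinTorusSite a' b' c' d')
    (hy : ∀ μ, finTorusSiteCoord y (σ μ) = finTorusSiteCoord x μ) (μ ν : Fin 4) :
    tHooftTwistFactor (fun i => z (σ.symm i)) y (σ μ) (σ ν) = tHooftTwistFactor z x μ ν := by
  have h3 : (σ ν = 3 ↔ ν = 3) := by
    constructor
    · intro h
      exact σ.injective (h.trans hσ.symm)
    · rintro rfl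
      exact hσ
  have hc3 : finTorusSiteCoord y 3 = finTorusSiteCoord x 3 := by
    have h := hy 3
    rwa [hσ] at h
  unfold tHooftTwistFactor
  simp only [hy, hc3, Equiv.symm_apply_apply, h3]

omit [TopologicalSpace G] [IsTopologicalGroup G] [CompactSpace G] [MeasurableSpace G] [BorelSpace G] in
/-- **The temporal cocycle under a permutation of the spatial axes** (oriented form of
`tHooftTwistFactor_spatialPerm`). [cite: tHooft1979Flux, §2 after (2.6)] -/
theorem tHooftTwistCocycle_spatialPerm {a b c d a' b' c' d' : ℕ} (σ : Equiv.Perm (Fin 4)) (hσ : σ 3 = 3)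
    (z : Fin 4 → G) (x : FinTorusSite a b c d) (y : FinTorusSite a' b' c' d')
    (hy : ∀ μ, finTorusSiteCoord y (σ μ) = finTorusSiteCoord x μ) (μ ν : Fin 4) :
    tHooftTwistCocycle (fun i => z (σ.symm i)) y (σ μ) (σ ν) = tHooftTwistCocycle z x μ ν := by
  unfold tHooftTwistCocycle
  rw [tHooftTwistFactor_spatialPerm σ hσ z x y hy μ ν, tHooftTwistFactor_spatialPerm σ hσ z x y hy ν μ]

/-- **Exchange of the spatial axes `0 ↔ 1`**: `Z^{(z)}_{ρ,β}(a,b,c,d) = Z^{(z ∘ (0 1))}_{ρ,β}(b,a,c,d)` — the temporal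
twist of direction `0` becomes the temporal twist of direction `1` and conversely, the box sides are exchanged; every
`z : Fin 4 → G`, compact `G`, continuous `ρ`, real `β` (a change of variables; no centrality).  't Hooft: `W{n_{μν}; a_μ}`
is invariant under joint rotations of `n_{μν}` and `a_μ`. [cite: tHooft1979Flux, §2 after (2.6)]
[cite: MontvayMunster1994, §3.2.6 (3.145)] -/
theorem wilsonFinTorusTwistedPartition_swap01 (hρ : Continuous ρ) (β : ℝ) (z : Fin 4 → G) (a b c d : ℕ) :
    wilsonFinTorusTwistedPartition ρ β z a b c d =
      wilsonFinTorusTwistedPartition ρ β (fun i => z (Equiv.swap (0 : Fin 4) 1 i)) b a c d :=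
  wilsonFinTorusTwistedPartition_relabel ρ hρ β
    (⟨fun x => (x.2.1, x.1, x.2.2.1, x.2.2.2), fun y => (y.2.1, y.1, y.2.2.1, y.2.2.2), fun _ => rfl, fun _ => rfl⟩ :
      FinTorusSite a b c d ≃ FinTorusSite b a c d)
    (Equiv.swap 0 1) (fun x μ => by fin_cases μ <;> rfl)
    (fun x μ ν => by
      have h := tHooftTwistCocycle_spatialPerm (Equiv.swap (0 : Fin 4) 1) (by decide) z x
        ((x.2.1, x.1, x.2.2.1, x.2.2.2) : FinTorusSite b a c d)
        (fun μ' => by rw [coord_swap01, Equiv.swap_apply_self]) μ ν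
      simpa only [Equiv.symm_swap, Equiv.coe_fn_mk] using h)

/-- **Exchange of the spatial axes `0 ↔ 2`**: `Z^{(z)}_{ρ,β}(a,b,c,d) = Z^{(z ∘ (0 2))}_{ρ,β}(c,b,a,d)`.
[cite: tHooft1979Flux, §2 after (2.6)] [cite: MontvayMunster1994, §3.2.6 (3.145)] -/
theorem wilsonFinTorusTwistedPartition_swap02 (hρ : Continuous ρ) (β : ℝ) (z : Fin 4 → G) (a b c d : ℕ) :
    wilsonFinTorusTwistedPartition ρ β z a b c d =
      wilsonFinTorusTwistedPartition ρ β (fun i => z (Equiv.swap (0 : Fin 4) 2 i)) c b a d :=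
  wilsonFinTorusTwistedPartition_relabel ρ hρ β
    (⟨fun x => (x.2.2.1, x.2.1, x.1, x.2.2.2), fun y => (y.2.2.1, y.2.1, y.1, y.2.2.2), fun _ => rfl, fun _ => rfl⟩ :
      FinTorusSite a b c d ≃ FinTorusSite c b a d)
    (Equiv.swap 0 2) (fun x μ => by fin_cases μ <;> rfl)
    (fun x μ ν => by
      have h := tHooftTwistCocycle_spatialPerm (Equiv.swap (0 : Fin 4) 2) (by decide) z x
        ((x.2.2.1, x.2.1, x.1, x.2.2.2) : FinTorusSite c b a d)
        (fun μ' => by rw [coord_swap02, Equiv.swap_apply_self]) μ ν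
      simpa only [Equiv.symm_swap, Equiv.coe_fn_mk] using h)

/-- **Exchange of the spatial axes `1 ↔ 2`**: `Z^{(z)}_{ρ,β}(a,b,c,d) = Z^{(z ∘ (1 2))}_{ρ,β}(a,c,b,d)`.
[cite: tHooft1979Flux, §2 after (2.6)] [cite: MontvayMunster1994, §3.2.6 (3.145)] -/
theorem wilsonFinTorusTwistedPartition_swap12 (hρ : Continuous ρ) (β : ℝ) (z : Fin 4 → G) (a b c d : ℕ) :
    wilsonFinTorusTwistedPartition ρ β z a b c d =
      wilsonFinTorusTwistedPartition ρ β (fun i => z (Equiv.swap (1 : Fin 4) 2 i)) a c b d :=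
  wilsonFinTorusTwistedPartition_relabel ρ hρ β
    (⟨fun x => (x.1, x.2.2.1, x.2.1, x.2.2.2), fun y => (y.1, y.2.2.1, y.2.1, y.2.2.2), fun _ => rfl, fun _ => rfl⟩ :
      FinTorusSite a b c d ≃ FinTorusSite a c b d)
    (Equiv.swap 1 2) (fun x μ => by fin_cases μ <;> rfl)
    (fun x μ ν => by
      have h := tHooftTwistCocycle_spatialPerm (Equiv.swap (1 : Fin 4) 2) (by decide) z x
        ((x.1, x.2.2.1, x.2.1, x.2.2.2) : FinTorusSite a c b d)
        (fun μ' => by rw [coord_swap12, Equiv.swap_apply_self]) μ ν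
      simpa only [Equiv.symm_swap, Equiv.coe_fn_mk] using h)

end Relabel

end Literature.MathematicalPhysics.QuantumFieldTheory

end
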